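import Summits.BirchSwinnertonDyer.Rank1Residual.JET.RingClassTransverseCount
import Summits.BirchSwinnertonDyer.BirchSwinnertonDyer.Theorems.Rank1ResidualJetSelmerLemmas
import Summits.BirchSwinnertonDyer.Rank1Residual.X5.KummerRelaxedStrictCount
import Summits.BirchSwinnertonDyer.Rank1Residual.GaloisImage.LocalH1TorsionBounded
import HarnessLib

/-!
# T1 JET (cell `bsd-jet`), road K: **the intrinsic transverse condition at a Kolyvagin prime is
# LAGRANGIAN** — the binder `h𝒯sd` of the H63 line DISCHARGED (Howard 2004 Prop. 2.1.9 (ii) =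
# Mazur–Rubin Prop. 1.3.2 (ii) for `L = K[ℓ]_λ`, at every odd prime-power level `p^k`, `k ≤ M(ℓ)`)
# (typer seat `bsd-jet-ty` g7; helper of `JET.tamagawaExponent_le_mInfty_of_localFacts'`; 0 classes move)

HONEST FRAMING (programme file §HONESTY, verbatim): «no tranche here proves BSD; ARM L moves the
LITERAL column of an r ≤ 1 census into the kernel-proved-modulo-named-print column.» THEOREMS ONLY
(no definition, no named fact, no `sorry`); nothing is booked; typed ≠ proved ≠ endorsed.

WHAT. For `W/ℚ` elliptic, `K` imaginary quadratic with `d_K < −4`, `ι : K → ℂ`, an odd prime `p`, a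
level `k ≥ 1`, a Kolyvagin prime `ℓ` of W. Zhang with `k ≤ M(ℓ)` (`p^k ∣ ℓ + 1`, `p^k ∣ a_ℓ`), `v = λ = (ℓ)`
and any place `w' ∣ λ` of `K[ℓ]`, with `Tr := transverseSubgroup (E[p^k]|_{K_λ}) (K[ℓ]_{w'})
= ker(H¹(K_λ, E[p^k]) → H¹(K[ℓ]_{w'}, E[p^k]))` (tree `DiscreteGaloisModule.transverseSubgroup`,
Mazur–Rubin Def. 1.1.6; Jetchev §3.1.2 `H¹_tr(K_λ) := H¹(K[ℓ]_λ/K_λ, E[p^k])`):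
* §3 `annRight_invWeilPairing_transverseSubgroup_ringClassField_eq` — LAGRANGIAN: `Tr` is its own right
  annihilator under `inv_λ(· ∪ₑ ·)` (isotropy, sibling `JET/RingClassTransverseCount` §1; the adjoint is
  bijective by local Tate duality for `E[p^k]` + `inv_λ` injective; `#Tr^⊥ · #Tr = #H¹ = #E(K_λ)[p^k]²`,
  Milne I Thm 2.8 = tree `natCard_galoisCohomology_one_torsion_adicCompletion_eq_sq_of_not_mem`; `#Tr =
  #E(K_λ)[p^k]`, sibling §2).
* §4 **`JET.RingClassTransverse.dualTransported_eq_of_localTransverseFamily`** — the binder `h𝒯sd` of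
  `JET.tamagawaExponent_le_mInfty_of_localFacts'` (`Theorems/Rank1ResidualJetThm63LocalFactsPrime`), in
  EXACTLY its shape (`∀ 𝒯` with the defining `⨅`-equation of `exists_localTransverseFamily`, `∀` Weil datum,
  `∀ inv.IsPerfect`, `∀ v ∈ placesDividing K c`), under: `c` square-free with Zhang–Kolyvagin prime factors and
  `k ≤ M(ℓ)` for all `ℓ ∣ c`, `p ≠ 2`, `1 ≤ k`, `d_K < −4` (= the context of that theorem; `d_K < −4` is its
  `KolyvaginAssembly.discr_lt_neg_four hK ⟨hD3, hD4⟩`, and `k ≤ M(ℓ)` follows from its `k + m_∞ ≤ M(c)`).  At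
  `v ∣ c` the filter of `c.primeFactors` by `ℓ ∈ v` is the single `ℓ₀` under `v`, the `⨅` over `w' ∣ v` is
  constant (`transverseSubgroup_adicCompletion_eq_of_liesOver`), and `w⁻¹(𝒯_v^*) = 𝒯_v^⊥`
  (`SelfDualCount.dualTransported_weilDual_eq_annRight`) `= 𝒯_v` by §3.

No «`Γ_{K_λ}` fixes `E[p^k]`» input is used (the count is `#E(K_λ)[p^k]`, whatever it is).
References: [cite: Howard2004HeegnerKolyvagin, Prop. 2.1.9 (ii), §2.2 (arXiv:1202.6340 p0005:L150–p0006:L5,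
p0006:L84–L92)] [cite: MazurRubin2004, Def. 1.1.6, Lemma 1.2.4, Prop. 1.3.2 (ii) (p. 12)] [cite: Rubin2011,
Def. 1.9.4, Prop. 1.9.5 (pp. 14–16)] [cite: Jetchev2008, §3.1.2 (p. 814)] [cite: MilneADT2006, Ch. I, Cor. 2.3,
Thm. 2.8] [cite: GrossLMS1991, §3 (p. 218 l. 1)] [cite: CasselsFrohlichANT1967, Ch. VII §1.1].

## Tree search
`lean search 'annRight_invWeilPairing_transverse|TransverseSelfDual|dualTransported.*transverse'`: the CYCLOTOMIC
engine `X5/TransverseSelfDual.annRight_invWeilPairing_transverse_eq` (prime level, `L = K_v(μ_ℓ)`); no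
ring-class-field statement — this file is its `L = K[ℓ]_λ`, level-`p^k` twin, re-using the same abstract bricks.
-/

set_option autoImplicit false

noncomputable section

open scoped Classical Pointwise

namespace Summit.BirchSwinnertonDyer.Rank1Residual.JET.RingClassTransverse

open CategoryTheory ContinuousCohomology WeierstrassCurve Field Function NumberField IsDedekindDomain
open Literature.NumberTheory.EllipticCurves Literature.NumberTheory.EllipticCurves.Jetchev2008
open Literature.NumberTheory.GaloisRepresentations Literature.NumberTheory.GaloisCohomology
open Literature.NumberTheory.GaloisRepresentations.DiscreteGaloisModule (mu MuCarrier transverseSubgroup SelmerStructure)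
open Literature.NumberTheory.Automorphic _root_.TopRep
open Summit.BirchSwinnertonDyer.Rank1Residual.GaloisImage
open Summit.BirchSwinnertonDyer.Rank1Residual.X11b.FiniteDuality
open Summit.BirchSwinnertonDyer.Rank1Residual.JET.SelmerVocabulary
open scoped ContRepresentation NumberField


variable (W : WeierstrassCurve ℚ) [W.IsElliptic] [W.IsGloballyMinimal] (K : Type) [Field K] [NumberField K]

/-! ## §3 LAGRANGIAN: `Tr` is its own right annihilator under `inv_λ(· ∪ₑ ·)` -/

/-- **`H¹_tr(K_λ, E[p^k])` is LAGRANGIAN** (its own right annihilator under `inv_λ(· ∪ₑ ·)`,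
`X11b.Relaxation.invWeilPairing`) at a Kolyvagin prime `ℓ` with `k ≤ M(ℓ)`, `p` odd, `1 ≤ k`, `K` imaginary
quadratic with `d_K < −4`: isotropy (§1); the right adjoint is bijective (local Tate duality for `E[p^k]`,
`eq_zero_of_forall_weilCupProduct_eq_zero_right_inr`, and `inv_λ` injective); `#Tr^⊥ · #Tr = #H¹(K_λ, E[p^k])
= #E(K_λ)[p^k]²` (`natCard_annRight_mul`, Milne I Thm 2.8) and `#Tr = #E(K_λ)[p^k]` (§2).  Howard 2004
Prop. 2.1.9 (ii) / Mazur–Rubin Prop. 1.3.2 (ii) for `T = E[p^k]`, `L = K[ℓ]_λ`.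
[cite: Howard2004HeegnerKolyvagin, Prop. 2.1.9 (ii)] [cite: MazurRubin2004, Prop. 1.3.2 (ii) (p. 12)]
[cite: MilneADT2006, Ch. I, Cor. 2.3, Thm. 2.8] -/
theorem annRight_invWeilPairing_transverseSubgroup_ringClassField_eq (hK : IsImaginaryQuadratic K)
    (hD : NumberField.discr K < -4) (ι : K →+* ℂ) [∀ j : ℕ, NumberField (ringClassField K ι j)]
    {p : ℕ} [hp : Fact p.Prime] (hp2 : p ≠ 2) {k : ℕ} (hk : 1 ≤ k) [NeZero (p ^ k)]
    {ℓ : ℕ} (hℓ : Zhang2014.IsKolyvaginPrime (W.conductorNorm ℤ) W K p ℓ) (hkℓ : k ≤ Zhang2014.kolyvaginIndex W p ℓ)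
    (v : HeightOneSpectrum (𝓞 K)) (hv : (ℓ : 𝓞 K) ∈ v.asIdeal)
    (w' : HeightOneSpectrum (𝓞 (ringClassField K ι ℓ))) [w'.asIdeal.LiesOver v.asIdeal]
    (e : geomTorsion (W.baseChange K) ((p ^ k : ℕ) : ℤ) → geomTorsion (W.baseChange K) ((p ^ k : ℕ) : ℤ) →
      AlgebraicClosure K)
    (hμ : ∀ S T, e S T ^ (p ^ k) = 1)
    (hadd₁ : ∀ S₁ S₂ T, e (S₁ + S₂) T = e S₁ T * e S₂ T)
    (hadd₂ : ∀ S T₁ T₂, e S (T₁ + T₂) = e S T₁ * e S T₂)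
    (hgal : ∀ (g : absoluteGaloisGroup K) (S T : geomTorsion (W.baseChange K) ((p ^ k : ℕ) : ℤ)),
      g • e S T = e (g • S) (g • T))
    (hnondeg : ∀ T, (∀ S, e S T = 1) → T = 0)
    (inv : LocalInvariants K (p ^ k)) (hinv : Injective (inv (Sum.inr v))) :
    annRight (X11b.Relaxation.invWeilPairing (W.baseChange K) (p ^ k) e hμ hadd₁ hadd₂ hgal inv (Sum.inr v))
        (letI := (adicCompletionOfLiesOver K (ringClassField K ι ℓ) v w').toAlgebra;
          transverseSubgroup (GaloisRep.toLocal v ((W.baseChange K).torsionGaloisModule ((p ^ k : ℕ) : ℤ)))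
            (w'.adicCompletion (ringClassField K ι ℓ))) =
      (letI := (adicCompletionOfLiesOver K (ringClassField K ι ℓ) v w').toAlgebra;
        transverseSubgroup (GaloisRep.toLocal v ((W.baseChange K).torsionGaloisModule ((p ^ k : ℕ) : ℤ)))
          (w'.adicCompletion (ringClassField K ι ℓ))) := by
  letI := (adicCompletionOfLiesOver K (ringClassField K ι ℓ) v w').toAlgebra
  haveI : CharZero (v.adicCompletion K) := charZero_adicCompletion v
  haveI : Finite (geomTorsion (W.baseChange K) ((p ^ k : ℕ) : ℤ)) :=
    finite_geomTorsion_of_neZero (W.baseChange K) (p ^ k)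
  haveI : CompactSpace (absoluteGaloisGroup (Place.Completion (Sum.inr v : Place K))) :=
    absoluteGaloisGroup_compactSpace _
  have hℓp : ℓ.Prime := hℓ.1
  -- `λ ∤ p`
  have hpv : ((p : ℕ) : 𝓞 K) ∉ v.asIdeal := by
    have h := (hasGoodReductionAt_of_zhangKolyvagin W K hp.out hℓ v hv 1).2
    rwa [pow_one, Int.cast_natCast] at h
  set b := X11b.Relaxation.invWeilPairing (W.baseChange K) (p ^ k) e hμ hadd₁ hadd₂ hgal inv (Sum.inr v) with hb
  set L := transverseSubgroup (GaloisRep.toLocal v ((W.baseChange K).torsionGaloisModule ((p ^ k : ℕ) : ℤ)))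
    (w'.adicCompletion (ringClassField K ι ℓ)) with hL
  haveI hfinA : Finite (galoisCohomology
      (((W.baseChange K).torsionGaloisModule ((p ^ k : ℕ) : ℤ)).toLocal (Sum.inr v : Place K)) 1) := by
    change Finite (galoisCohomology (GaloisRep.restrictField (v.adicCompletion K)
      ((W.baseChange K).torsionGaloisModule ((p ^ k : ℕ) : ℤ))) 1)
    exact finite_galoisCohomology_one_of_isNonarchimedeanLocalField _
  haveI hfinB : Finite (galoisCohomology
      (GaloisRep.toLocal v ((W.baseChange K).torsionGaloisModule ((p ^ k : ℕ) : ℤ))) 1) :=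
    finite_galoisCohomology_one_of_isNonarchimedeanLocalField _
  have hA : ∀ x : galoisCohomology
      (((W.baseChange K).torsionGaloisModule ((p ^ k : ℕ) : ℤ)).toLocal (Sum.inr v : Place K)) 1, (p ^ k) • x = 0 :=
    nsmul_continuousCohomology_one_eq_zero _ (p ^ k)
      (fun T : geomTorsion (W.baseChange K) ((p ^ k : ℕ) : ℤ) ↦ AddSubgroup.torsionBy.nsmul T)
  haveI := finite_addMonoidHom_zmod (galoisCohomology
    (((W.baseChange K).torsionGaloisModule ((p ^ k : ℕ) : ℤ)).toLocal (Sum.inr v : Place K)) 1) (p ^ k)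
  -- (1) isotropy `L ≤ L^⊥` (§1)
  have hle : L ≤ annRight b L := fun y hy x hx ↦ by
    have h0 := weilCupProduct_eq_zero_of_mem_transverseSubgroup_ringClassField W K hK hD ι hp.out hp2 k hℓ v hv w'
      e hμ hadd₁ hadd₂ hgal hx hy
    rw [hb, X11b.Relaxation.invWeilPairing_apply]
    exact (congrArg (inv (Sum.inr v)) h0).trans (map_zero _)
  -- (2) the right adjoint is bijective (local Tate duality for `E[p^k]` + `inv_v` injective)
  have hflip : Bijective b.flip := by
    have hinj : Injective b.flip := by
      intro y y' h
      rw [← sub_eq_zero]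
      refine eq_zero_of_forall_weilCupProduct_eq_zero_right_inr (W.baseChange K) (p ^ k) e hμ hadd₁ hadd₂ v hgal
        hnondeg _ fun x ↦ ?_
      have h1 : b x (y - y') = 0 := by
        rw [map_sub, sub_eq_zero]
        exact DFunLike.congr_fun h x
      rw [hb, X11b.Relaxation.invWeilPairing_apply] at h1
      exact hinv (h1.trans (map_zero _).symm)
    exact hinj.bijective_of_nat_card_le (Nat.card_addMonoidHom_zmod hA).le
  have hNL : Nat.card (annRight b L) * Nat.card L =
      Nat.card (galoisCohomology (((W.baseChange K).torsionGaloisModule ((p ^ k : ℕ) : ℤ)).toLocal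
        (Sum.inr v : Place K)) 1) :=
    natCard_annRight_mul hA b hflip L
  -- (3) the counts: `#H¹ = #E(K_v)[p^k]²` (Milne I 2.8) and `#L = #E(K_v)[p^k]` (§2)
  have hH1 : Nat.card (galoisCohomology (((W.baseChange K).torsionGaloisModule ((p ^ k : ℕ) : ℤ)).toLocal
        (Sum.inr v : Place K)) 1) =
      Nat.card (nsmulAddMonoidHom (p ^ k) :
        ((W.baseChange K).baseChange (v.adicCompletion K)).toAffine.Point →+ _).ker ^ 2 := by
    have h := natCard_galoisCohomology_one_torsion_adicCompletion_eq_sq_of_not_mem (W.baseChange K) v p hpv (k - 1)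
    rw [Nat.sub_add_cancel hk] at h
    exact h
  have hLc : Nat.card L = Nat.card (nsmulAddMonoidHom (p ^ k) :
      ((W.baseChange K).baseChange (v.adicCompletion K)).toAffine.Point →+ _).ker :=
    natCard_transverseSubgroup_ringClassField_eq W K hK hD ι k hℓ hkℓ v hv w'
  have hLpos : 0 < Nat.card L := Nat.card_pos
  have hann : Nat.card (annRight b L) ≤ Nat.card L := by
    have h2 : Nat.card (annRight b L) * Nat.card L = Nat.card L * Nat.card L := by
      rw [hNL, hH1, hLc, sq]
    exact (Nat.eq_of_mul_eq_mul_right hLpos h2).le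
  exact (AddSubgroup.eq_of_le_of_card_ge hle hann).symm

/-! ## §4 The binder `h𝒯sd` of `JET.tamagawaExponent_le_mInfty_of_localFacts'`, DISCHARGED -/

/-- **T1-K — the INTRINSIC TRANSVERSE FAMILY IS SELF-DUAL (LAGRANGIAN) at the places dividing `c`: the binder
`h𝒯sd` of `JET.tamagawaExponent_le_mInfty_of_localFacts'` (`Theorems/Rank1ResidualJetThm63LocalFactsPrime`),
in exactly its shape, is a THEOREM.**  Hypotheses (all in that theorem's context): `W/ℚ` elliptic globally
minimal, `K` imaginary quadratic with `d_K < −4` (`KolyvaginAssembly.discr_lt_neg_four hK ⟨hD3, hD4⟩`),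
`ι : K → ℂ`, ring class fields number fields, `p ≠ 2` prime, `1 ≤ k`, `c` square-free with Zhang–Kolyvagin
prime factors, `k ≤ M(ℓ)` for every `ℓ ∣ c` (e.g. from `k + m_∞ ≤ M(c)`, `Zhang2014.le_levelIndex_iff`).
CONCLUSION: for every Selmer structure `𝒯` whose finite-place conditions are the `⨅`-rendering of
`exists_localTransverseFamily` (p509971), every Weil datum `e` on `E[p^k]/K`, every family `inv` with local
Tate duality (`IsPerfect`) and every `v ∈ placesDividing K c`:
`inv.dualTransported 𝒯 (weilDualIntertwining …) (Sum.inr v) = 𝒯 (Sum.inr v)`.  At `v ∣ c` the filter is the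
single prime `ℓ₀` under `v`, the `⨅` over `w' ∣ v` is the transverse subgroup at any one `w'`
(`transverseSubgroup_adicCompletion_eq_of_liesOver`), `w⁻¹(𝒯_v^*) = 𝒯_v^⊥`
(`SelfDualCount.dualTransported_weilDual_eq_annRight`) and §3 applies.  Howard 2004 Prop. 2.1.9 (ii) = Mazur–Rubin
Prop. 1.3.2 (ii) = Jetchev 2008 §3.1.2 «`H¹_tr(K_λ, E[p^m])` is self-dual with respect to the Tate local pairing».
[cite: Howard2004HeegnerKolyvagin, Prop. 2.1.9 (ii), §2.2] [cite: MazurRubin2004, Prop. 1.3.2 (ii) (p. 12)]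
[cite: Jetchev2008, §3.1.2 (p. 814)] [cite: MilneADT2006, Ch. I, Cor. 2.3, Thm. 2.8] -/
theorem dualTransported_eq_of_localTransverseFamily (hK : IsImaginaryQuadratic K)
    (hD : NumberField.discr K < -4) (ι : K →+* ℂ) [∀ j : ℕ, NumberField (ringClassField K ι j)]
    (p : ℕ) [hp : Fact p.Prime] (hp2 : p ≠ 2) (k : ℕ) (hk : 1 ≤ k) [NeZero (p ^ k)]
    [Finite (geomTorsion (W.baseChange K) ((p ^ k : ℕ) : ℤ))]
    (c : ℕ) (hc : Squarefree c)
    (hkol : ∀ ℓ ∈ c.primeFactors, Zhang2014.IsKolyvaginPrime (W.conductorNorm ℤ) W K p ℓ)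
    (hkM : ∀ ℓ ∈ c.primeFactors, k ≤ Zhang2014.kolyvaginIndex W p ℓ)
    (𝒯 : SelmerStructure ((W.baseChange K).torsionGaloisModule ((p ^ k : ℕ) : ℤ)))
    (h𝒯 : ∀ v : HeightOneSpectrum (𝓞 K), 𝒯 (Sum.inr v) =
      ⨅ ℓ ∈ c.primeFactors.filter (fun ℓ : ℕ ↦ ((ℓ : ℕ) : 𝓞 K) ∈ v.asIdeal),
        ⨅ (w' : HeightOneSpectrum (𝓞 (ringClassField K ι ℓ))) (_ : w'.asIdeal.LiesOver v.asIdeal),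
          letI := (adicCompletionOfLiesOver K (ringClassField K ι ℓ) v w').toAlgebra
          transverseSubgroup (GaloisRep.toLocal v ((W.baseChange K).torsionGaloisModule ((p ^ k : ℕ) : ℤ)))
            (w'.adicCompletion (ringClassField K ι ℓ)))
    (e : geomTorsion (W.baseChange K) ((p ^ k : ℕ) : ℤ) → geomTorsion (W.baseChange K) ((p ^ k : ℕ) : ℤ) →
      AlgebraicClosure K)
    (hμ : ∀ S T, e S T ^ (p ^ k) = 1)
    (hadd₁ : ∀ S₁ S₂ T, e (S₁ + S₂) T = e S₁ T * e S₂ T)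
    (hadd₂ : ∀ S T₁ T₂, e S (T₁ + T₂) = e S T₁ * e S T₂)
    (hgal : ∀ (g : absoluteGaloisGroup K) (S T : geomTorsion (W.baseChange K) ((p ^ k : ℕ) : ℤ)),
      g • e S T = e (g • S) (g • T))
    (_halt : ∀ T, e T T = 1) (hnondeg : ∀ T, (∀ S, e S T = 1) → T = 0)
    (inv : LocalInvariants K (p ^ k)) (hperf : inv.IsPerfect)
    (v : HeightOneSpectrum (𝓞 K)) (hvc : v ∈ placesDividing K c) :
    inv.dualTransported 𝒯 (weilDualIntertwining (W.baseChange K) (p ^ k) e hμ hadd₁ hadd₂ hgal) (Sum.inr v) =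
      𝒯 (Sum.inr v) := by
  have hc0 : c ≠ 0 := hc.ne_zero
  -- the prime `ℓ₀ ∣ c` under `v`, unique
  obtain ⟨ℓ₀, hℓ₀c, hℓ₀v⟩ := (natCast_mem_iff_exists_primeFactor_mem hc0 v).mp
    ((mem_placesDividing_iff_natCast_mem hc0 v).mp hvc)
  have hℓ₀ := hkol ℓ₀ hℓ₀c
  have hℓ₀p : ℓ₀.Prime := hℓ₀.1
  have hℓ₀0 : ℓ₀ ≠ 0 := hℓ₀p.ne_zero
  have huniq : ∀ ℓ ∈ c.primeFactors, ((ℓ : ℕ) : 𝓞 K) ∈ v.asIdeal → ℓ = ℓ₀ := by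
    intro ℓ hℓc hℓv
    by_contra hne
    have hcop : Nat.Coprime ℓ₀ ℓ :=
      (Nat.coprime_primes hℓ₀p (Nat.prime_of_mem_primeFactors hℓc)).mpr (Ne.symm hne)
    exact X11b.Three.Koly.Method2.not_mem_asIdeal_of_coprime K hcop v hℓ₀v hℓv
  -- a place `w₀ ∣ v` of `K[ℓ₀]`
  haveI := (finiteDimensional_and_isGalois_ringClassField hK ι hℓ₀0).2
  obtain ⟨w₀⟩ := (inferInstance : Nonempty (SemiLocal.Place K (ringClassField K ι ℓ₀) v))
  haveI hw₀ : (w₀ : HeightOneSpectrum (𝓞 (ringClassField K ι ℓ₀))).asIdeal.LiesOver v.asIdeal :=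
    SemiLocal.Place.liesOver w₀
  letI := (adicCompletionOfLiesOver K (ringClassField K ι ℓ₀) v (w₀ : HeightOneSpectrum (𝓞 (ringClassField K ι ℓ₀)))).toAlgebra
  -- `𝒯_v` is the transverse subgroup at `w₀`
  have h𝒯v : 𝒯 (Sum.inr v) =
      transverseSubgroup (GaloisRep.toLocal v ((W.baseChange K).torsionGaloisModule ((p ^ k : ℕ) : ℤ)))
        ((w₀ : HeightOneSpectrum (𝓞 (ringClassField K ι ℓ₀))).adicCompletion (ringClassField K ι ℓ₀)) := by
    rw [h𝒯 v]
    ext y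
    simp only [AddSubgroup.mem_iInf, Finset.mem_filter, and_imp]
    constructor
    · intro H
      exact H ℓ₀ hℓ₀c hℓ₀v (w₀ : HeightOneSpectrum (𝓞 (ringClassField K ι ℓ₀))) hw₀
    · intro hy ℓ hℓc hℓv w' hw'
      obtain rfl := huniq ℓ hℓc hℓv
      rw [transverseSubgroup_adicCompletion_eq_of_liesOver
        ((W.baseChange K).torsionGaloisModule ((p ^ k : ℕ) : ℤ)) (ringClassField K ι ℓ) v w'
        (w₀ : HeightOneSpectrum (𝓞 (ringClassField K ι ℓ)))]
      exact hy
  rw [X5.SelfDualCount.dualTransported_weilDual_eq_annRight (W.baseChange K) (p ^ k) e hμ hadd₁ hadd₂ hgal inv 𝒯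
    (Sum.inr v), h𝒯v]
  exact annRight_invWeilPairing_transverseSubgroup_ringClassField_eq W K hK hD ι hp2 hk hℓ₀ (hkM ℓ₀ hℓ₀c) v hℓ₀v
    (w₀ : HeightOneSpectrum (𝓞 (ringClassField K ι ℓ₀))) e hμ hadd₁ hadd₂ hgal hnondeg inv (hperf v).1.injective

end Summit.BirchSwinnertonDyer.Rank1Residual.JET.RingClassTransverse

end
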